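import Mathlib
import HarnessLib
import Summits.ResolutionOfSingularities.ResolutionOfSingularities.Theorems.HomologicalConductorNoZenoStableAnnihilatorReduction

set_option linter.dupNamespace false

/-!
# The one-step lemma of Iyengar–Takahashi (Remark 2.12), general form

`[OURS · L w44b · completion model, ascent half · res-type-015 gen 15]` — first brick towards the
discharge of the named fact `Literature.RingTheory.CohomologyAnnihilator.le_caCompletion_comap`
([BahlekehHakimianSalarianTakahashi2015, Thm. 4.5 (2)]), helper for the surface rung
`PersistenceSurface` (stmt-ResolutionOfSingularities-19970) of crux chain w44b.  NOT a statement of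
the manuscript under adjudication in cell res-hironaka; pure commutative algebra over Mathlib and the
tree's `Literature.RingTheory.CohomologyAnnihilator` library (`IsSyzygy`, `StablyAnnihilates`).

[IyengarTakahashi2014, Remark 2.12]: *if `a` annihilates `Ext¹(M, ΩM)` then there is an exact
sequence `0 → (0 :_M a) → M ⊕ ΩM → Ω(M/aM) → 0`.*  The tree's
`exists_retract_isSyzygy_quotSMulTop` (`ReductionModRegular.lean`) is the special case `a`
`M`-regular (then `(0 :_M a) = 0` and `M` is a retract of `Ω(M/aM)`).  Here the general form, with
the hypothesis in the shape «`a • 𝟙 M` factors through a finitely generated projective»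
(`StablyAnnihilates`, which is what `a • Ext¹(M, ΩM) = 0` yields by the splitting criterion):

* `exists_cover_lift_of_stablyAnnihilates` — a stable annihilation `M → P₀ → M` of a finitely
  generated `M` can be moved onto a SURJECTIVE finitely generated projective cover `π : P ↠ M`:
  `π ψ = a • 𝟙` (add a finite free cover to `P₀`);
* `exists_shortExact_torsionBy_prod_syzygy` — **the one-step lemma**: for `M` finitely generated and
  stably annihilated by `a` there are a first syzygy `K = ΩM`, a first syzygy `L = Ω(M/aM)` of
  `M/aM` and a short exact sequence `0 → (0 :_M a) → M ⊕ K → L → 0` (`(0 :_M a)` = Mathlib's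
  `Submodule.torsionBy`).  Construction: `K = Ker π`, `L = π⁻¹(aM) = Ker(P → M/aM)`,
  `(m, k) ↦ ψ m + k`, kernel `{(m, -ψ m) : a m = 0}`.

This is the engine of the induction «every punctured-free module over a completion-like pair is a
retract of a base change» (sibling files `…CompletionAscent*`).

References: S. B. Iyengar, R. Takahashi, *Annihilation of cohomology and strong generation of module
categories*, IMRN 2016; arXiv:1404.1476 — Remark 2.12 [`IyengarTakahashi2014`].
-/

noncomputable section

open CategoryTheory CategoryTheory.Limits Literature.RingTheory.CohomologyAnnihilator
open Summit.ResolutionOfSingularities.ResolutionOfSingularities.Theorems.NoZeno.SandwichCluster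
open scoped Pointwise

universe u

namespace Summit.ResolutionOfSingularities.ResolutionOfSingularities.Theorems.HomologicalConductor.CompletionAscentOneStep

variable {T : Type u} [CommRing T]

/-- A stable annihilation of a finitely generated module can be realised on a surjective cover: if
`a • 𝟙 M` factors through a finitely generated projective, then there are a finitely generated
projective `P`, a SURJECTION `π : P ↠ M` and `ψ : M → P` with `π (ψ m) = a • m` (add a finite free
cover `F ↠ M` to the given `P₀` and let `ψ` land in the `P₀` summand). [folklore] -/
theorem exists_cover_lift_of_stablyAnnihilates {a : T} {M : ModuleCat.{u} T} [Module.Finite T M]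
    (h : StablyAnnihilates T a M) :
    ∃ (P : ModuleCat.{u} T) (_ : Module.Finite T P) (_ : Projective P) (π : P →ₗ[T] M)
      (ψ : M →ₗ[T] P), Function.Surjective π ∧ ∀ m : M, π (ψ m) = a • m := by
  obtain ⟨P₀, hP₀, hP₀proj, ι, π₀, hιπ⟩ := h
  obtain ⟨n, q, hq⟩ := Module.Finite.exists_fin' T M
  haveI := hP₀
  refine ⟨ModuleCat.of T (P₀ × (Fin n → T)), inferInstance,
    projective_prod hP₀proj ((IsProjective.iff_projective (R := T) (Fin n → T)).mp inferInstance),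
    π₀.hom.coprod q, (LinearMap.inl T P₀ (Fin n → T)) ∘ₗ ι.hom, ?_, fun m => ?_⟩
  · intro m
    obtain ⟨f, rfl⟩ := hq m
    exact ⟨(0, f), by simp⟩
  · have := congrArg (fun φ : M ⟶ M => φ.hom m) hιπ
    simpa using this

/-- **One-step lemma [IyengarTakahashi2014, Remark 2.12], general form.**  Let `M` be a finitely
generated `T`-module stably annihilated by `a` (`a • 𝟙 M` factors through a finitely generated
projective).  Then there are a first syzygy `K` of `M`, a first syzygy `L` of `M/aM`, and a short
exact sequence `0 → (0 :_M a) → M ⊕ K → L → 0`.  With a cover `π : P ↠ M` and `π ψ = a • 𝟙`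
(`exists_cover_lift_of_stablyAnnihilates`): `K = Ker π`, `L = Ker(P ↠ M/aM) = π⁻¹(aM)` (a first
syzygy of `M/aM`), the surjection `M ⊕ K → L` is `(m, k) ↦ ψ m + k`, and its kernel
`{(m, -ψ m) | a m = 0}` is `(0 :_M a) = Submodule.torsionBy T M a`.
[cite: IyengarTakahashi2014, Remark 2.12] -/
theorem exists_shortExact_torsionBy_prod_syzygy {a : T} {M : ModuleCat.{u} T} [Module.Finite T M]
    (h : StablyAnnihilates T a M) :
    ∃ (K L : ModuleCat.{u} T), IsSyzygy 1 M K ∧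
      IsSyzygy 1 (ModuleCat.of T (M ⧸ (a • ⊤ : Submodule T M))) L ∧
      ∃ (f : ModuleCat.of T (Submodule.torsionBy T M a) ⟶ ModuleCat.of T (M × K))
        (g : ModuleCat.of T (M × K) ⟶ L) (w : f ≫ g = 0), (ShortComplex.mk f g w).ShortExact := by
  obtain ⟨P, hPfin, hPproj, π, ψ, hπ, hψ⟩ := exists_cover_lift_of_stablyAnnihilates h
  haveI := hPfin
  -- `K = Ker π`, a first syzygy of `M`
  let K : Submodule T P := LinearMap.ker π
  obtain ⟨wK, hSK⟩ := exists_shortExact_of_linearMap (Y := ModuleCat.of T K) (M := P) (X := M)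
    K.subtype π Subtype.val_injective hπ (LinearMap.exact_subtype_ker_map π)
  have hK : IsSyzygy 1 M (ModuleCat.of T K) := isSyzygy_one_iff.mpr ⟨P, hPfin, hPproj, _, _, wK, hSK⟩
  -- `L = Ker (P → M/aM)`, a first syzygy of `M/aM`
  let ρ : P →ₗ[T] M ⧸ (a • ⊤ : Submodule T M) := (a • ⊤ : Submodule T M).mkQ ∘ₗ π
  have hρ : Function.Surjective ρ := (Submodule.mkQ_surjective _).comp hπ
  let L : Submodule T P := LinearMap.ker ρ
  obtain ⟨wL, hSL⟩ := exists_shortExact_of_linearMap (Y := ModuleCat.of T L) (M := P)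
    (X := ModuleCat.of T (M ⧸ (a • ⊤ : Submodule T M))) L.subtype ρ Subtype.val_injective hρ
    (LinearMap.exact_subtype_ker_map ρ)
  have hL : IsSyzygy 1 (ModuleCat.of T (M ⧸ (a • ⊤ : Submodule T M))) (ModuleCat.of T L) :=
    isSyzygy_one_iff.mpr ⟨P, hPfin, hPproj, _, _, wL, hSL⟩
  -- `θ : M ⊕ K → L`, `(m, k) ↦ ψ m + k`
  have hψL : ∀ m : M, ψ m ∈ L := fun m => by
    change (a • ⊤ : Submodule T M).mkQ (π (ψ m)) = 0
    rw [hψ, Submodule.mkQ_apply, Submodule.Quotient.mk_eq_zero]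
    exact Submodule.smul_mem_pointwise_smul _ _ _ trivial
  have hKL : ∀ k : K, (k : P) ∈ L := fun k => by
    change (a • ⊤ : Submodule T M).mkQ (π k) = 0
    rw [LinearMap.mem_ker.mp k.2, map_zero]
  let θ : (M × K) →ₗ[T] L :=
    LinearMap.codRestrict L (ψ ∘ₗ LinearMap.fst T M K ∘ₗ LinearMap.id + K.subtype ∘ₗ LinearMap.snd T M K)
      fun mk => L.add_mem (hψL mk.1) (hKL mk.2)
  have hθ : ∀ mk : M × K, (θ mk : P) = ψ mk.1 + mk.2 := fun mk => rfl
  have hθsurj : Function.Surjective θ := by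
    intro l
    have hl : π (l : P) ∈ (a • ⊤ : Submodule T M) := by
      have h0 : ρ l = 0 := l.2
      change (a • ⊤ : Submodule T M).mkQ (π l) = 0 at h0
      rwa [Submodule.mkQ_apply, Submodule.Quotient.mk_eq_zero] at h0
    obtain ⟨m, -, hm⟩ := (Submodule.mem_smul_pointwise_iff_exists _ _ _).1 hl
    have hk : (l : P) - ψ m ∈ K := by
      rw [LinearMap.mem_ker, map_sub, hψ, ← hm]
      exact sub_self _
    refine ⟨(m, ⟨_, hk⟩), Subtype.ext ?_⟩
    rw [hθ]
    change ψ m + ((l : P) - ψ m) = l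
    abel
  -- `α : (0 :_M a) → M ⊕ K`, `m ↦ (m, -ψ m)`
  have hψK : ∀ m : Submodule.torsionBy T M a, -ψ (m : M) ∈ K := fun m => by
    rw [LinearMap.mem_ker, map_neg, hψ, neg_eq_zero]
    exact (Submodule.mem_torsionBy_iff a (m : M)).mp m.2
  let α : Submodule.torsionBy T M a →ₗ[T] (M × K) :=
    LinearMap.prod (Submodule.torsionBy T M a).subtype
      (LinearMap.codRestrict K (-(ψ ∘ₗ (Submodule.torsionBy T M a).subtype)) hψK)
  have hα : ∀ m : Submodule.torsionBy T M a, α m = ((m : M), ⟨-ψ (m : M), hψK m⟩) := fun m => rfl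
  have hαinj : Function.Injective α := fun m₁ m₂ hm =>
    Subtype.ext (congrArg Prod.fst hm)
  have hαθ : Function.Exact α θ := by
    intro mk
    constructor
    · intro h0
      have h1 : ψ mk.1 + (mk.2 : P) = 0 := by
        have := congrArg Subtype.val h0
        rwa [hθ] at this
      have h2 : (mk.2 : P) = -ψ mk.1 := eq_neg_of_add_eq_zero_right h1
      have h3 : a • mk.1 = 0 := by
        have hk2 : π (mk.2 : P) = 0 := LinearMap.mem_ker.mp mk.2.2
        rw [h2, map_neg, hψ, neg_eq_zero] at hk2
        exact hk2
      refine ⟨⟨mk.1, (Submodule.mem_torsionBy_iff a mk.1).mpr h3⟩, ?_⟩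
      rw [hα]
      exact Prod.ext rfl (Subtype.ext h2.symm)
    · rintro ⟨m, rfl⟩
      apply Subtype.ext
      rw [hθ, hα]
      change ψ (m : M) + -ψ (m : M) = ((0 : L) : P)
      rw [add_neg_cancel]
      rfl
  obtain ⟨w, hS⟩ := exists_shortExact_of_linearMap
    (Y := ModuleCat.of T (Submodule.torsionBy T M a)) (M := ModuleCat.of T (M × K))
    (X := ModuleCat.of T L) α θ hαinj hθsurj hαθ
  exact ⟨ModuleCat.of T K, ModuleCat.of T L, hK, hL, _, _, w, hS⟩

end Summit.ResolutionOfSingularities.ResolutionOfSingularities.Theorems.HomologicalConductor.CompletionAscentOneStep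

end
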